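import Literature.Analysis.InnerProduct.LensSpaceGeneratingFunctionResidues
import Literature.Analysis.InnerProduct.LensSpaceHomogeneousSpectralRigidity
import Literature.Analysis.InnerProduct.HigherLensSpaceMultiplicityInvariance
import Literature.NumberTheory.Transcendental.OkadaCotangentProofs
import HarnessLib

/-!
# Ikeda–Yamamoto's Main Theorem for a prime order of the fundamental group: two isospectral three-dimensional lens spaces
# `L(q; p₁, p₂)`, `L(q; p₁', p₂')` with `q` an odd prime are isometric (Ikeda–Yamamoto 1979, §5 Lemma 5.3 and §6)

Layer `Literature/Analysis/InnerProduct`, namespace `Literature.Analysis.InnerProduct`; lane `lit-hodgefound`, prover seat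
`lit-hodgefound-p06`, generation 45, row g45-#2. THEOREMS only (no definition, no instance, no notation, no named fact).

## Source, verbatim (held text `paper:doi-10-18910-4811`)

A. Ikeda, Y. Yamamoto, *On the spectra of 3-dimensional lens spaces*, Osaka J. Math. **16** (1979) 447–469. Introduction (p. 447):
"**Main Theorem.** Let `q` be a positive integer. If two 3-dimensional lens spaces with fundamental group of order `q` are
isospectral to each other, then they are isometric to each other. This theorem will be shown here in this paper only for
`q = l^ν`, `2l^ν` and `2^ν` where `l` is an odd prime and `ν ≥ 1`." §4 (p. 453): "**Proposition 4.1.** Let `L(q : p₁)` and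
`L(q : p₂)` be 3-dimensional lens spaces. Then, the lens space `L(q : p₁)` is isometric to `L(q : p₂)` if either (4.1)
`p₁ ± p₂ ≡ 0 (mod q)`, or (4.2) `p₁p₂ ≡ ±1 (mod q)`." §5 (p. 458): "**Lemma 5.3.** Let `q` be an arbitrary natural number. Then
the real numbers `cot(π/q)k` (`1 ≤ k < q/2`, `(k, q) = 1`) are linearly independent over `Q`." §6 (p. 459–460): "**Lemma 6.1.**
Main Theorem holds when `q ≤ 10`. … In the following, we assume `L(q : p₁)` is isospectral to `L(q : p₂)` and `q > 10` and also
assume `p₁, p₂ ≢ ±1 (mod q)`. … **Proof of Main Theorem for odd prime `q`.** Assume `q` is an odd prime. By Proposition 4.1,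
it is sufficient to show that either `p₁ ≡ ±p₂ (mod q)` or `p₁ ≡ ±p₂* (mod q)`. Substituting `k = 1` (which satisfies (4.13)
and (4.14)) in the formula (4.18), we have (6.2) [the eight-term cotangent relation with `k = 1`]. Assume `p₁ ≢ ±p₂` and
`p₁ ≢ ±p₂* (mod q)`. Applying Lemma 5.3 to (6.2), only the following cases are possible … This contradicts our assumption.
q.e.d."

## The proof, as formalised

* LEMMA 5.3 is the tree's theorem of Chowla–Okada `Literature.NumberTheory.Transcendental.okada_linearIndependent_cot_of_units`
  (file `NumberTheory/Transcendental/OkadaCotangentProofs.lean`): for units `v_l` mod `q`, pairwise distinct with no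
  `v_l ≡ −v_{l'}`, the numbers `cot(πṽ_l/q)` are `ℚ`-linearly independent. §1 recasts it in the form in which §6 applies it:
  an ODD function `f : ℤ/q → ℚ` supported on the units with `∑_a f(a)·cot(πã/q) = 0` vanishes identically
  (`eq_zero_of_odd_of_sum_mul_cot_eq_zero`; fold the sum onto the half-system `2ã < q`, where the family is signed-free).
* §2: a signed family of non-zero points `aᵢ ∈ ℤ/q` with rational weights `εᵢ` has
  `∑_x (∑ᵢ εᵢ([x = aᵢ] − [x = −aᵢ]))·cot(πx̃/q) = 2∑ᵢ εᵢ cot(πãᵢ/q)` (`cot` is odd on `ℤ/q`), so if the `aᵢ` are units and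
  `∑ᵢ εᵢ cot(πãᵢ/q) = 0` then the odd function `x ↦ ∑ᵢ εᵢ([x = aᵢ] − [x = −aᵢ])` vanishes identically
  (`sum_signedIndicator_eq_zero_of_sum_mul_cot_eq_zero`) — this is "applying Lemma 5.3 to (6.2)".
* §3 (the combinatorics of §6, done uniformly instead of by the source's case list (6.3)–(6.7)): write `P = p₁`, `U = p₁*`,
  `Q = p₂`, `V = p₂*` in `ℤ/q` and `N_P(y) = [y = P] + [y = −P] + [y = U] + [y = −U]` (the multiplicity of `y` in the class
  `{±p₁, ±p₁*}` which, by Proposition 4.1, IS the isometry class of `L(q : p₁)`). The eight points of (6.2) are `P ± 1`,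
  `U ± 1`, `Q ± 1`, `V ± 1` with signs `+−+−`, `−+−+`, and the vanishing of the signed indicator at `x = y + 1` reads
  `N_P(y) − N_P(y+2) = N_Q(y) − N_Q(y+2)`: the difference `D = N_P − N_Q` is `2`-PERIODIC on `ℤ/q`
  (`classCount_sub_classCount_add_two`). For odd `q` the element `2` generates `ℤ/q` additively, so `D` is constant
  (`eq_apply_zero_of_forall_apply_add_two`), and `D(0) = 0` (`0` is in neither class): `N_P = N_Q`. Evaluating at `y = Q`
  gives `Q ∈ {±P, ±U}` (`eq_or_eq_neg_of_classCount_eq`, `eq_or_eq_neg_of_cot_relation`), i.e. `p₂ ≡ ±p₁` or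
  `p₁p₂ ≡ ±1` — (4.1)/(4.2). The hypotheses needed along the way are exactly the source's:
  `q` odd (`q ∤ 2k`, `k = 1`), and `pᵢ ≢ ±1` so that the eight points are units of the prime field (for `pᵢ ≡ ±1` — the
  homogeneous case — the tree's COROLLARY 3.4 `dvd_sub_or_dvd_add_of_lensMultiplicity_eq` applies instead, which is also how
  Lemma 6.1 of the source disposes of `q ≤ 10`).
* §4: THE MAIN THEOREM for `q` an odd prime — normalized form `L(q; 1, p₁)` vs `L(q; 1, p₂)`
  (`dvd_of_lensMultiplicity_one_eq_of_prime`), general weights via `L(q; p₁, p₂) ≅ L(q; 1, p₁*p₂)` (the tree's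
  `lensMultiplicity_eq_one_left`; `dvd_of_lensMultiplicity_eq_of_prime`), PROPOSITION 4.1 as the equivalence of the
  congruences with Ikeda's criterion `LensWeightsEquivalent q ![p₁, p₂] ![p₁', p₂']` of the tree (Theorem 2.1 (4) of
  [Ikeda1980] = Proposition 1.1 of the source: isometric), and the equivalence ISOSPECTRAL ⟺ ISOMETRIC for prime `q`
  (`lensMultiplicity_eq_iff_lensWeightsEquivalent_of_prime`; the converse is the tree's
  `LensWeightsEquivalent.lensSpaceMultiplicity_eq`).

## References

* [IkedaYamamoto1979] A. Ikeda, Y. Yamamoto, *On the spectra of 3-dimensional lens spaces*, Osaka J. Math. 16 (1979) 447–469: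
  Main Theorem, Proposition 4.1, Corollary 4.7 (4.18), Lemma 5.3, Lemma 6.1, §6 (6.2)–(6.7).
* [Okada1981] T. Okada, *On an extension of a theorem of S. Chowla*, Acta Arith. 38 (1980/81) 341–345 (Lemma 5.3 for all `q`;
  S. Chowla, J. Number Theory 2 (1970) for prime `q`).
* [Ikeda1980] A. Ikeda, *On lens spaces which are isospectral but not isometric*, Ann. Sci. ÉNS (4) 13 (1980) 303–315,
  Theorem 2.1 (the isometry criterion `LensWeightsEquivalent`).
-/

noncomputable section

open Finset Filter Topology Complex

namespace Literature.Analysis.InnerProduct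

open _root_.Real _root_.Filter _root_.Topology Literature.NumberTheory.Transcendental

/-! ### §1 LEMMA 5.3 in the odd-function form: an odd `f : ℤ/q → ℚ` on the units with `∑ f(a)cot(πã/q) = 0` is zero -/

/-- A unit of `ℤ/q`, `q ≥ 3`, is non-zero and its representative is not `q/2`. [folklore] -/
private theorem ne_zero_and_two_mul_val_ne {q : ℕ} (hq : 2 < q) {a : ZMod q} (ha : IsUnit a) :
    a ≠ 0 ∧ 2 * a.val ≠ q := by
  haveI : NeZero q := ⟨by omega⟩
  haveI : Nontrivial (ZMod q) := ZMod.nontrivial_iff.mpr (by omega)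
  refine ⟨ha.ne_zero, fun h ↦ ?_⟩
  have h2 : (2 : ZMod q) * a = 0 := by
    have : (((2 * a.val : ℕ)) : ZMod q) = 0 := by rw [h, ZMod.natCast_self]
    push_cast at this
    rwa [ZMod.natCast_zmod_val] at this
  have h3 : (2 : ZMod q) = 0 := by
    obtain ⟨u, rfl⟩ := ha
    have := congrArg (· * (↑u⁻¹ : ZMod q)) h2
    simpa using this
  have h4 : (q : ℤ) ∣ 2 := by
    have : ((2 : ℤ) : ZMod q) = 0 := by exact_mod_cast h3
    exact (ZMod.intCast_zmod_eq_zero_iff_dvd 2 q).mp this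
  have := Int.le_of_dvd two_pos h4
  omega

/-- `cot(π(−a)~/q) = −cot(πã/q)` for `a ≠ 0` (`(−a)~ = q − ã`, `cot(π − x) = −cot x`). [folklore] -/
private theorem cot_neg_val {q : ℕ} [NeZero q] {a : ZMod q} (ha : a ≠ 0) :
    Complex.cot (π * ((-a).val : ℂ) / q) = -Complex.cot (π * (a.val : ℂ) / q) := by
  have hq : (q : ℂ) ≠ 0 := Nat.cast_ne_zero.mpr (NeZero.ne q)
  rw [ZMod.neg_val, if_neg ha, Nat.cast_sub (ZMod.val_lt a).le,
    show (π : ℂ) * ((q : ℂ) - (a.val : ℂ)) / q = π - π * (a.val : ℂ) / q by field_simp,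
    Complex.cot_eq_cos_div_sin, Complex.cot_eq_cos_div_sin, Complex.cos_pi_sub, Complex.sin_pi_sub, neg_div]

/-- **LEMMA 5.3 (Ikeda–Yamamoto 1979) in the odd-function form** — a corollary of the tree's theorem of Chowla–Okada
(`okada_linearIndependent_cot_of_units`: the cotangents `cot(πṽ/q)` of a signed-free family of units are `ℚ`-linearly
independent): for `q ≥ 3`, an odd function `f : ℤ/q → ℚ` supported on the units with `∑_{a ∈ ℤ/q} f(a)·cot(πã/q) = 0`
vanishes identically (fold the sum onto the half-system `{a unit : 2ã < q}` using `f(−a)cot(π(−a)~/q) = f(a)cot(πã/q)`, apply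
linear independence there, and recover the other half by oddness). [cite: IkedaYamamoto1979, Lemma 5.3] [cite: Okada1981, Theorem] -/
theorem eq_zero_of_odd_of_sum_mul_cot_eq_zero {q : ℕ} [NeZero q] (hq : 2 < q) (f : ZMod q → ℚ)
    (hodd : ∀ a, f (-a) = -f a) (hsupp : ∀ a, ¬ IsUnit a → f a = 0)
    (hrel : ∑ a : ZMod q, (f a : ℂ) * Complex.cot (π * (a.val : ℂ) / q) = 0) : f = 0 := by
  classical
  set T : Finset (ZMod q) := Finset.univ.filter (fun a : ZMod q ↦ IsUnit a ∧ 2 * a.val < q) with hT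
  have hmemT : ∀ a : ZMod q, a ∈ T ↔ IsUnit a ∧ 2 * a.val < q := fun a ↦ by simp [hT]
  -- `−T` is the other half of the units
  have hnegT : ∀ {a : ZMod q}, IsUnit a → a ∉ T → -a ∈ T := by
    intro a ha haT
    obtain ⟨ha0, ha2⟩ := ne_zero_and_two_mul_val_ne hq ha
    rw [hmemT] at haT ⊢
    have hlt : ¬ 2 * a.val < q := fun h ↦ haT ⟨ha, h⟩
    refine ⟨ha.neg, ?_⟩
    rw [ZMod.neg_val, if_neg ha0]
    have := ZMod.val_lt a
    omega
  have hnotboth : ∀ {a : ZMod q}, a ∈ T → -a ∉ T := by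
    intro a haT hnaT
    rw [hmemT] at haT hnaT
    obtain ⟨ha0, _⟩ := ne_zero_and_two_mul_val_ne hq haT.1
    have h1 := hnaT.2
    rw [ZMod.neg_val, if_neg ha0] at h1
    have := ZMod.val_lt a
    have hv : 0 < a.val := Nat.pos_of_ne_zero fun h0 ↦ ha0 ((ZMod.val_eq_zero a).mp h0)
    omega
  -- fold the relation onto `T`
  set F : ZMod q → ℂ := fun a ↦ (f a : ℂ) * Complex.cot (π * (a.val : ℂ) / q) with hF
  have hFneg : ∀ {a : ZMod q}, a ≠ 0 → F (-a) = F a := by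
    intro a ha0
    simp only [hF, hodd a, cot_neg_val ha0, Rat.cast_neg, neg_mul_neg]
  have hvanish : ∀ a ∈ (Finset.univ : Finset (ZMod q)), a ∉ T ∪ T.image (fun a ↦ -a) → F a = 0 := by
    intro a _ ha
    rw [Finset.mem_union] at ha
    by_cases hu : IsUnit a
    · exfalso
      by_cases haT : a ∈ T
      · exact ha (Or.inl haT)
      · exact ha (Or.inr (Finset.mem_image.mpr ⟨-a, hnegT hu haT, neg_neg a⟩))
    · simp only [hF, hsupp a hu, Rat.cast_zero, zero_mul]
  have hdisj : Disjoint T (T.image fun a ↦ -a) := by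
    rw [Finset.disjoint_left]
    rintro a haT haT'
    obtain ⟨b, hbT, rfl⟩ := Finset.mem_image.mp haT'
    exact hnotboth hbT haT
  have himage : ∑ a ∈ T.image (fun a ↦ -a), F a = ∑ a ∈ T, F a := by
    rw [Finset.sum_image fun a _ b _ h ↦ neg_injective h]
    refine Finset.sum_congr rfl fun a haT ↦ hFneg ?_
    exact (ne_zero_and_two_mul_val_ne hq ((hmemT a).mp haT).1).1
  have hfold : ∑ a : ZMod q, F a = 2 * ∑ a ∈ T, F a := by
    rw [← Finset.sum_subset (Finset.subset_univ _) hvanish, Finset.sum_union hdisj, himage, two_mul]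
  have hT0 : ∑ a ∈ T, F a = 0 := by
    have h := hrel
    rw [show ∑ a : ZMod q, (f a : ℂ) * Complex.cot (π * (a.val : ℂ) / q) = ∑ a : ZMod q, F a from rfl, hfold] at h
    exact (mul_eq_zero.mp h).resolve_left two_ne_zero
  -- linear independence on the half-system
  have hli := okada_linearIndependent_cot_of_units (q := q) (by omega) (fun l : T ↦ (l.1 : ZMod q))
    (fun l ↦ ((hmemT l.1).mp l.2).1) (fun l l' h ↦ Subtype.ext h)
    (fun l l' h ↦ hnotboth l'.2 (by rw [← h]; exact l.2))
  have hrelR : ∑ l : T, (f l.1) • Real.cot (π * ((l.1 : ZMod q).val : ℝ) / q) = 0 := by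
    have hC : ((∑ l : T, (f l.1) • Real.cot (π * ((l.1 : ZMod q).val : ℝ) / q) : ℝ) : ℂ) = ∑ a ∈ T, F a := by
      simp only [Rat.smul_def]
      push_cast
      rw [Finset.sum_coe_sort T (fun a : ZMod q ↦ (f a : ℂ) * Complex.cot (π * (a.val : ℂ) / q))]
    exact Complex.ofReal_eq_zero.mp (hC.trans hT0)
  have hzeroT : ∀ a ∈ T, f a = 0 := fun a haT ↦
    (linearIndependent_iff'.mp hli) Finset.univ (fun l : T ↦ f l.1) hrelR ⟨a, haT⟩ (Finset.mem_univ _)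
  funext a
  by_cases hu : IsUnit a
  · by_cases haT : a ∈ T
    · exact hzeroT a haT
    · have h := hzeroT (-a) (hnegT hu haT)
      rw [hodd] at h
      simpa using h
  · exact hsupp a hu

/-! ### §2 "Applying Lemma 5.3 to (6.2)": a signed family of unit points with vanishing cotangent sum has vanishing
signed indicator -/

/-- **The cotangent sum of a signed indicator**: for non-zero points `aᵢ ∈ ℤ/q` and weights `εᵢ`,
`∑_{x ∈ ℤ/q} (∑ᵢ εᵢ([x = aᵢ] − [x = −aᵢ]))·cot(πx̃/q) = 2∑ᵢ εᵢ cot(πãᵢ/q)` (`cot(π(−a)~/q) = −cot(πã/q)`).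
[cite: IkedaYamamoto1979, §6 (proof of the Main Theorem for odd prime `q`: "Applying Lemma 5.3 to (6.2)")] -/
theorem sum_signedIndicator_mul_cot {q : ℕ} [NeZero q] {ι : Type*} [Fintype ι] (a : ι → ZMod q) (ha : ∀ i, a i ≠ 0)
    (ε : ι → ℂ) :
    ∑ x : ZMod q, (∑ i, ε i * ((if x = a i then (1 : ℂ) else 0) - (if x = -a i then (1 : ℂ) else 0))) *
        Complex.cot (π * (x.val : ℂ) / q) =
      2 * ∑ i, ε i * Complex.cot (π * ((a i).val : ℂ) / q) := by
  classical
  simp_rw [Finset.sum_mul]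
  rw [Finset.sum_comm, Finset.mul_sum]
  refine Finset.sum_congr rfl fun i _ ↦ ?_
  have hx : ∀ x : ZMod q, ε i * ((if x = a i then (1 : ℂ) else 0) - (if x = -a i then (1 : ℂ) else 0)) *
      Complex.cot (π * (x.val : ℂ) / q) =
      (if x = a i then ε i * Complex.cot (π * (x.val : ℂ) / q) else 0) -
        (if x = -a i then ε i * Complex.cot (π * (x.val : ℂ) / q) else 0) := by
    intro x
    split_ifs <;> ring
  rw [Finset.sum_congr rfl fun x _ ↦ hx x, Finset.sum_sub_distrib, Finset.sum_ite_eq', Finset.sum_ite_eq',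
    if_pos (Finset.mem_univ _), if_pos (Finset.mem_univ _), cot_neg_val (ha i)]
  ring

/-- **"Applying Lemma 5.3 to (6.2)"**: if `aᵢ` are units of `ℤ/q` (`q ≥ 3`), `εᵢ ∈ ℤ`, and `∑ᵢ εᵢ cot(πãᵢ/q) = 0`, then the
signed indicator vanishes: `∑ᵢ εᵢ([x = aᵢ] − [x = −aᵢ]) = 0` for every `x ∈ ℤ/q` (it is an odd function on the units whose
cotangent sum is `2∑ᵢ εᵢ cot(πãᵢ/q) = 0`; Lemma 5.3). In words: in a vanishing rational combination of the `cot(πãᵢ/q)`, the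
total signed weight of every class `{a, −a}` is zero. [cite: IkedaYamamoto1979, Lemma 5.3 and §6] -/
theorem sum_signedIndicator_eq_zero_of_sum_mul_cot_eq_zero {q : ℕ} [NeZero q] (hq : 2 < q) {ι : Type*} [Fintype ι]
    (a : ι → ZMod q) (ha : ∀ i, IsUnit (a i)) (ε : ι → ℤ)
    (hrel : ∑ i, (ε i : ℂ) * Complex.cot (π * ((a i).val : ℂ) / q) = 0) (x : ZMod q) :
    ∑ i, ε i * ((if x = a i then (1 : ℤ) else 0) - (if x = -a i then (1 : ℤ) else 0)) = 0 := by
  classical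
  haveI : Nontrivial (ZMod q) := ZMod.nontrivial_iff.mpr (by omega)
  have h := eq_zero_of_odd_of_sum_mul_cot_eq_zero hq
    (fun x : ZMod q ↦ ((∑ i, ε i * ((if x = a i then (1 : ℤ) else 0) - (if x = -a i then (1 : ℤ) else 0)) : ℤ) : ℚ))
    ?_ ?_ ?_
  · have hx := congrFun h x
    simp only [Pi.zero_apply, Int.cast_eq_zero] at hx
    exact hx
  · -- odd
    intro x
    simp only [neg_eq_iff_eq_neg, ← Int.cast_neg, ← Finset.sum_neg_distrib]
    congr 1
    refine Finset.sum_congr rfl fun i _ ↦ ?_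
    ring
  · -- supported on the units
    intro x hx
    simp only [Int.cast_eq_zero]
    refine Finset.sum_eq_zero fun i _ ↦ ?_
    rw [if_neg (fun h : x = a i ↦ hx (h ▸ ha i)), if_neg (fun h : x = -a i ↦ hx (h ▸ (ha i).neg)), sub_zero, mul_zero]
  · -- the cotangent sum
    have e1 : ∀ x : ZMod q,
        (((∑ i, ε i * ((if x = a i then (1 : ℤ) else 0) - (if x = -a i then (1 : ℤ) else 0)) : ℤ) : ℚ) : ℂ) =
        ∑ i, (ε i : ℂ) * ((if x = a i then (1 : ℂ) else 0) - (if x = -a i then (1 : ℂ) else 0)) := by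
      intro x
      push_cast
      refine Finset.sum_congr rfl fun i _ ↦ ?_
      split_ifs <;> push_cast <;> ring
    simp_rw [e1]
    rw [sum_signedIndicator_mul_cot a (fun i ↦ (ha i).ne_zero) (fun i ↦ (ε i : ℂ)), hrel, mul_zero]

/-! ### §3 The combinatorics of §6: the signed multiplicity of the class `{±p, ±p*}` is `2`-periodic, hence constant -/

/-- `y + 1 = t + 1 ↔ y = t`, `y + 1 = −(t + 1) ↔ y + 2 = −t`, `y + 1 = t − 1 ↔ y + 2 = t`, `y + 1 = −(t − 1) ↔ y = −t`: the eight
points `t ± 1` of (6.2), seen from `x = y + 1`. [folklore] -/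
private theorem shift_iffs {R : Type*} [CommRing R] (y t : R) :
    (y + 1 = t + 1 ↔ y = t) ∧ (y + 1 = -(t + 1) ↔ y + 2 = -t) ∧ (y + 1 = t - 1 ↔ y + 2 = t) ∧
      (y + 1 = -(t - 1) ↔ y = -t) := by
  refine ⟨⟨fun h ↦ ?_, fun h ↦ ?_⟩, ⟨fun h ↦ ?_, fun h ↦ ?_⟩, ⟨fun h ↦ ?_, fun h ↦ ?_⟩, ⟨fun h ↦ ?_, fun h ↦ ?_⟩⟩ <;>
    linear_combination h

/-- **The vanishing signed indicator of (6.2), read at `x = y + 1`.** Let `P, U, Q, V ∈ ℤ/q` (`q ≥ 3`) be such that the eight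
points `P ± 1`, `U ± 1`, `Q ± 1`, `V ± 1` are units, and suppose the relation (6.2) = (4.18) with `k = 1`:
`cot(π(P+1)~/q) − cot(π(P−1)~/q) + cot(π(U+1)~/q) − cot(π(U−1)~/q) = ` the same for `Q, V`. Then with
`N_{P,U}(y) = [y = P] + [y = −P] + [y = U] + [y = −U]` (the multiplicity of `y` in `(P, −P, U, −U)`):
`N_{P,U}(y) − N_{P,U}(y + 2) = N_{Q,V}(y) − N_{Q,V}(y + 2)` for every `y` — the difference `N_{P,U} − N_{Q,V}` is
`2`-periodic. (Lemma 5.3 applied to (6.2): the total signed weight of every class `{x, −x}` among the eight signed points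
vanishes; at `x = y + 1` the eight memberships `[y + 1 = ±(t ± 1)]` are `[y = ±t]`, `[y + 2 = ±t]`.)
[cite: IkedaYamamoto1979, §6 (proof of the Main Theorem for odd prime `q`), Lemma 5.3] -/
theorem classCount_sub_classCount_add_two {q : ℕ} [NeZero q] (hq : 2 < q) {P U Q V : ZMod q}
    (hP1 : IsUnit (P + 1)) (hP2 : IsUnit (P - 1)) (hU1 : IsUnit (U + 1)) (hU2 : IsUnit (U - 1))
    (hQ1 : IsUnit (Q + 1)) (hQ2 : IsUnit (Q - 1)) (hV1 : IsUnit (V + 1)) (hV2 : IsUnit (V - 1))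
    (hrel : Complex.cot (π * ((P + 1).val : ℂ) / q) - Complex.cot (π * ((P - 1).val : ℂ) / q) +
        (Complex.cot (π * ((U + 1).val : ℂ) / q) - Complex.cot (π * ((U - 1).val : ℂ) / q)) =
      Complex.cot (π * ((Q + 1).val : ℂ) / q) - Complex.cot (π * ((Q - 1).val : ℂ) / q) +
        (Complex.cot (π * ((V + 1).val : ℂ) / q) - Complex.cot (π * ((V - 1).val : ℂ) / q)))
    (y : ZMod q) :
    ((if y = P then (1 : ℤ) else 0) + (if y = -P then 1 else 0) + (if y = U then 1 else 0) + (if y = -U then 1 else 0)) -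
      ((if y + 2 = P then (1 : ℤ) else 0) + (if y + 2 = -P then 1 else 0) + (if y + 2 = U then 1 else 0) +
        (if y + 2 = -U then 1 else 0)) =
    ((if y = Q then (1 : ℤ) else 0) + (if y = -Q then 1 else 0) + (if y = V then 1 else 0) + (if y = -V then 1 else 0)) -
      ((if y + 2 = Q then (1 : ℤ) else 0) + (if y + 2 = -Q then 1 else 0) + (if y + 2 = V then 1 else 0) +
        (if y + 2 = -V then 1 else 0)) := by
  classical
  -- the eight signed points of (6.2)
  have h := sum_signedIndicator_eq_zero_of_sum_mul_cot_eq_zero hq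
    ![P + 1, P - 1, U + 1, U - 1, Q + 1, Q - 1, V + 1, V - 1]
    (by intro i; fin_cases i <;> assumption) ![1, -1, 1, -1, -1, 1, -1, 1]
    (by simp only [Fin.sum_univ_eight, Matrix.cons_val]; push_cast; linear_combination hrel) (y + 1)
  simp only [Fin.sum_univ_eight, Matrix.cons_val] at h
  obtain ⟨aP, bP, cP, dP⟩ := shift_iffs y P
  obtain ⟨aU, bU, cU, dU⟩ := shift_iffs y U
  obtain ⟨aQ, bQ, cQ, dQ⟩ := shift_iffs y Q
  obtain ⟨aV, bV, cV, dV⟩ := shift_iffs y V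
  simp only [aP, bP, cP, dP, aU, bU, cU, dU, aQ, bQ, cQ, dQ, aV, bV, cV, dV] at h
  linear_combination h

/-- **A `2`-periodic function on `ℤ/q`, `q` odd, is constant** (`2` generates `ℤ/q` additively). [folklore] -/
private theorem eq_apply_zero_of_forall_apply_add_two {q : ℕ} [NeZero q] {M : Type*} (h2 : IsUnit (2 : ZMod q)) {D : ZMod q → M}
    (hD : ∀ y, D (y + 2) = D y) (y : ZMod q) : D y = D 0 := by
  have hn : ∀ n : ℕ, D (2 * (n : ZMod q)) = D 0 := by
    intro n
    induction n with
    | zero => simp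
    | succ n ih => rw [show (2 : ZMod q) * ((n + 1 : ℕ) : ZMod q) = 2 * (n : ZMod q) + 2 by push_cast; ring, hD, ih]
  obtain ⟨w, hw⟩ := h2
  have hy : y = 2 * (((↑w⁻¹ : ZMod q) * y).val : ZMod q) := by
    rw [ZMod.natCast_zmod_val, ← mul_assoc, ← hw, Units.mul_inv, one_mul]
  rw [hy]
  exact hn _

/-- **The class `{±p, ±p*}` is recovered from its multiplicity function**: if `N_{P,U} = N_{Q,V}` pointwise then
`Q ∈ {P, −P, U, −U}` (evaluate at `y = Q`, where `N_{Q,V}(Q) ≥ 1`). [cite: IkedaYamamoto1979, §6 and Proposition 4.1] -/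
theorem eq_or_eq_neg_of_classCount_eq {q : ℕ} {P U Q V : ZMod q}
    (h : ∀ y : ZMod q, ((if y = P then (1 : ℤ) else 0) + (if y = -P then 1 else 0) + (if y = U then 1 else 0) +
        (if y = -U then 1 else 0)) =
      ((if y = Q then (1 : ℤ) else 0) + (if y = -Q then 1 else 0) + (if y = V then 1 else 0) + (if y = -V then 1 else 0))) :
    Q = P ∨ Q = -P ∨ Q = U ∨ Q = -U := by
  classical
  by_contra hne
  simp only [not_or] at hne
  obtain ⟨h1, h2, h3, h4⟩ := hne
  have hQ := h Q
  rw [if_neg h1, if_neg h2, if_neg h3, if_neg h4, if_pos rfl] at hQ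
  split_ifs at hQ <;> omega

/-- **§6 for a general odd modulus, combinatorial core.** Let `q ≥ 3` with `2` invertible mod `q`, and let `P, U, Q, V` be
non-zero elements of `ℤ/q` such that the eight points `P ± 1`, `U ± 1`, `Q ± 1`, `V ± 1` are units and the cotangent relation
(6.2) holds. Then `Q ∈ {P, −P, U, −U}`. (The `2`-periodic difference `N_{P,U} − N_{Q,V}` is constant, and it vanishes at `0`
since `0 ∉ {±P, ±U, ±Q, ±V}`; so `N_{P,U} = N_{Q,V}`.) With `U = P* `, `V = Q*` (`p₁p₁* ≡ 1`, `p₂p₂* ≡ 1`) this is the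
source's conclusion "either `p₁ ≡ ±p₂ (mod q)` or `p₁ ≡ ±p₂* (mod q)`". [cite: IkedaYamamoto1979, §6 (proof of the Main
Theorem for odd prime `q`, (6.2)–(6.7))] -/
theorem eq_or_eq_neg_of_cot_relation {q : ℕ} [NeZero q] (hq : 2 < q) (h2 : IsUnit (2 : ZMod q)) {P U Q V : ZMod q}
    (hP0 : P ≠ 0) (hU0 : U ≠ 0) (hQ0 : Q ≠ 0) (hV0 : V ≠ 0)
    (hP1 : IsUnit (P + 1)) (hP2 : IsUnit (P - 1)) (hU1 : IsUnit (U + 1)) (hU2 : IsUnit (U - 1))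
    (hQ1 : IsUnit (Q + 1)) (hQ2 : IsUnit (Q - 1)) (hV1 : IsUnit (V + 1)) (hV2 : IsUnit (V - 1))
    (hrel : Complex.cot (π * ((P + 1).val : ℂ) / q) - Complex.cot (π * ((P - 1).val : ℂ) / q) +
        (Complex.cot (π * ((U + 1).val : ℂ) / q) - Complex.cot (π * ((U - 1).val : ℂ) / q)) =
      Complex.cot (π * ((Q + 1).val : ℂ) / q) - Complex.cot (π * ((Q - 1).val : ℂ) / q) +
        (Complex.cot (π * ((V + 1).val : ℂ) / q) - Complex.cot (π * ((V - 1).val : ℂ) / q))) :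
    Q = P ∨ Q = -P ∨ Q = U ∨ Q = -U := by
  classical
  -- `D = N_{P,U} − N_{Q,V}` is `2`-periodic, hence constant, hence `= D(0) = 0`
  have hper := classCount_sub_classCount_add_two hq hP1 hP2 hU1 hU2 hQ1 hQ2 hV1 hV2 hrel
  have hD := eq_apply_zero_of_forall_apply_add_two (q := q) h2
    (D := fun y : ZMod q ↦ ((if y = P then (1 : ℤ) else 0) + (if y = -P then 1 else 0) + (if y = U then 1 else 0) +
        (if y = -U then 1 else 0)) -
      ((if y = Q then (1 : ℤ) else 0) + (if y = -Q then 1 else 0) + (if y = V then 1 else 0) + (if y = -V then 1 else 0)))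
    (fun y ↦ by linear_combination -(hper y))
  have hD0 : ((if (0 : ZMod q) = P then (1 : ℤ) else 0) + (if (0 : ZMod q) = -P then 1 else 0) +
        (if (0 : ZMod q) = U then 1 else 0) + (if (0 : ZMod q) = -U then 1 else 0)) -
      ((if (0 : ZMod q) = Q then (1 : ℤ) else 0) + (if (0 : ZMod q) = -Q then 1 else 0) +
        (if (0 : ZMod q) = V then 1 else 0) + (if (0 : ZMod q) = -V then 1 else 0)) = 0 := by
    rw [if_neg (fun h ↦ hP0 h.symm), if_neg (fun h ↦ hP0 (neg_eq_zero.mp h.symm)), if_neg (fun h ↦ hU0 h.symm),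
      if_neg (fun h ↦ hU0 (neg_eq_zero.mp h.symm)), if_neg (fun h ↦ hQ0 h.symm),
      if_neg (fun h ↦ hQ0 (neg_eq_zero.mp h.symm)), if_neg (fun h ↦ hV0 h.symm),
      if_neg (fun h ↦ hV0 (neg_eq_zero.mp h.symm))]
    norm_num
  refine eq_or_eq_neg_of_classCount_eq (V := V) fun y ↦ ?_
  have e := hD y
  rw [hD0] at e
  linear_combination e

/-! ### §4 THE MAIN THEOREM for `q` an odd prime: isospectral three-dimensional lens spaces are isometric -/

/-- `cot(πt/q) = cot(πt̃/q)` with `t̃ ∈ [0, q)` the representative of `t mod q` (`e(t) = e(t̃)` in `i·cot(πt/q) =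
(1 + e(t))/(1 − e(t))`). [folklore] -/
private theorem cot_intCast_eq_cot_val {q : ℕ} [NeZero q] (t : ℤ) :
    Complex.cot (π * t / q) = Complex.cot (π * (((t : ZMod q).val : ℕ) : ℂ) / q) := by
  have hq : (q : ℂ) ≠ 0 := Nat.cast_ne_zero.mpr (NeZero.ne q)
  obtain ⟨m, hm⟩ : (q : ℤ) ∣ t - (((t : ZMod q).val : ℕ) : ℤ) := by
    rw [← ZMod.intCast_zmod_eq_zero_iff_dvd]
    push_cast
    rw [ZMod.natCast_zmod_val, sub_self]
  have he : cexp (2 * π * I * t / q) = cexp (2 * π * I * ((((t : ZMod q).val : ℕ) : ℤ) : ℂ) / q) := by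
    rw [Complex.exp_eq_exp_iff_exists_int]
    refine ⟨m, ?_⟩
    have ht : (t : ℂ) = ((((t : ZMod q).val : ℕ) : ℤ) : ℂ) + (q : ℂ) * (m : ℂ) := by
      exact_mod_cast (show t = (((t : ZMod q).val : ℕ) : ℤ) + q * m by linear_combination hm)
    rw [ht]
    field_simp
  have h1 := I_mul_cot_eq_ratio q t
  have h2 := I_mul_cot_eq_ratio q ((((t : ZMod q).val : ℕ) : ℤ))
  rw [he] at h1
  push_cast at h1 h2
  exact mul_left_cancel₀ I_ne_zero (h1.trans h2.symm)

/-- `q ∤ t ⇒ t ≠ 0` in `ℤ/q`. [folklore] -/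
private theorem cast_ne_zero_of_not_dvd {q : ℕ} {t : ℤ} (ht : ¬ (q : ℤ) ∣ t) : (t : ZMod q) ≠ 0 :=
  fun h0 ↦ ht ((ZMod.intCast_zmod_eq_zero_iff_dvd _ _).mp h0)

/-- `pp* ≡ 1 (mod q)` read in `ℤ/q`. [folklore] -/
private theorem cast_mul_cast_eq_one' {q : ℕ} {p u : ℤ} (hu : (q : ℤ) ∣ u * p - 1) :
    (u : ZMod q) * (p : ZMod q) = 1 := by
  have h := (ZMod.intCast_zmod_eq_zero_iff_dvd (u * p - 1) q).mpr hu
  push_cast at h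
  exact sub_eq_zero.mp h

/-- **MAIN THEOREM (Ikeda–Yamamoto 1979) for an odd prime `q`, normalized weights.** Let `q` be an odd prime and `p₁, p₂`
prime to `q`. If the three-dimensional lens spaces `L(q; 1, p₁)` and `L(q; 1, p₂)` are isospectral — `dim E_{n(n+2)}` agree
for all `n` — then `p₁ ≡ ±p₂ (mod q)` or `p₁p₂ ≡ ±1 (mod q)`, i.e. (Proposition 4.1) `L(q; 1, p₁)` and `L(q; 1, p₂)` are
isometric. Proof as in §6 of the source: the homogeneous case `pᵢ ≡ ±1` is Corollary 3.4 (the tree's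
`dvd_sub_or_dvd_add_of_lensMultiplicity_eq`); otherwise (4.18) with `k = 1` (the tree's
`cot_alternatingSum_eq_of_lensMultiplicity_eq`) and Lemma 5.3 (the tree's theorem of Chowla–Okada) force
`p₂ ∈ {±p₁, ±p₁*}` (`eq_or_eq_neg_of_cot_relation`). [cite: IkedaYamamoto1979, Main Theorem (`q` an odd prime), §6,
Proposition 4.1] -/
theorem dvd_of_lensMultiplicity_one_eq_of_prime {q : ℕ} [hq : Fact q.Prime] (hq2 : q ≠ 2) {p₁ p₂ : ℤ}
    (hp₁ : IsCoprime p₁ q) (hp₂ : IsCoprime p₂ q) (h : ∀ n : ℕ, lensMultiplicity q 1 p₁ n = lensMultiplicity q 1 p₂ n) :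
    (q : ℤ) ∣ p₁ - p₂ ∨ (q : ℤ) ∣ p₁ + p₂ ∨ (q : ℤ) ∣ p₁ * p₂ - 1 ∨ (q : ℤ) ∣ p₁ * p₂ + 1 := by
  haveI : NeZero q := ⟨hq.out.ne_zero⟩
  have hq3 : 2 < q := by have := hq.out.two_le; omega
  have h1cop : IsCoprime (1 : ℤ) q := isCoprime_one_left
  -- the homogeneous case: COROLLARY 3.4
  have hom : ∀ {a b : ℤ}, IsCoprime b q → (∀ n : ℕ, lensMultiplicity q 1 a n = lensMultiplicity q 1 b n) →
      ((q : ℤ) ∣ a - 1 ∨ (q : ℤ) ∣ a + 1) → (q : ℤ) ∣ a - b ∨ (q : ℤ) ∣ a + b := by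
    intro a b hb hab hhom
    have hhom' : (q : ℤ) ∣ 1 - a ∨ (q : ℤ) ∣ 1 + a := by
      rcases hhom with hh | hh
      · exact Or.inl (by rw [← dvd_neg, neg_sub]; exact hh)
      · exact Or.inr (by rwa [add_comm])
    rcases dvd_sub_or_dvd_add_of_lensMultiplicity_eq q h1cop h1cop hb hhom' hab with hb' | hb'
    · rcases hhom with hh | hh
      · left; have := dvd_add hh hb'; rwa [show a - 1 + (1 - b) = a - b by ring] at this
      · right; have := dvd_sub hh hb'; rwa [show a + 1 - (1 - b) = a + b by ring] at this
    · rcases hhom with hh | hh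
      · right; have := dvd_add hh hb'; rwa [show a - 1 + (1 + b) = a + b by ring] at this
      · left; have := dvd_sub hh hb'; rwa [show a + 1 - (1 + b) = a - b by ring] at this
  by_cases hhom₁ : (q : ℤ) ∣ p₁ - 1 ∨ (q : ℤ) ∣ p₁ + 1
  · rcases hom hp₂ h hhom₁ with h' | h'
    · exact Or.inl h'
    · exact Or.inr (Or.inl h')
  by_cases hhom₂ : (q : ℤ) ∣ p₂ - 1 ∨ (q : ℤ) ∣ p₂ + 1
  · rcases hom hp₁ (fun n ↦ (h n).symm) hhom₂ with h' | h'
    · exact Or.inl (by rw [← dvd_neg, neg_sub]; exact h')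
    · exact Or.inr (Or.inl (by rwa [add_comm]))
  -- the generic case: both spaces non-homogeneous; (4.18) with `k = 1`
  rw [not_or] at hhom₁ hhom₂
  obtain ⟨u₁, b₁, hub₁⟩ := hp₁
  obtain ⟨u₂, b₂, hub₂⟩ := hp₂
  have hu₁ : (q : ℤ) ∣ u₁ * p₁ - 1 := ⟨-b₁, by linear_combination hub₁⟩
  have hu₂ : (q : ℤ) ∣ u₂ * p₂ - 1 := ⟨-b₂, by linear_combination hub₂⟩
  have h2 : ¬ (q : ℤ) ∣ 2 * 1 := by
    intro hd
    have := Int.le_of_dvd (by norm_num) hd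
    have h2q : (2 : ℤ) < q := by exact_mod_cast hq3
    omega
  have hrel := cot_alternatingSum_eq_of_lensMultiplicity_eq (k := 1) hu₁ hu₂ h2
    (by rw [one_mul]; exact hhom₁.1) (by rw [one_mul]; exact hhom₁.2) (by rw [one_mul]; exact hhom₂.1)
    (by rw [one_mul]; exact hhom₂.2) h
  simp only [cot_intCast_eq_cot_val (q := q)] at hrel
  have c1 : ((1 * (p₁ + 1) : ℤ) : ZMod q) = (p₁ : ZMod q) + 1 := by push_cast; ring
  have c2 : ((1 * (p₁ - 1) : ℤ) : ZMod q) = (p₁ : ZMod q) - 1 := by push_cast; ring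
  have c3 : ((1 * (u₁ + 1) : ℤ) : ZMod q) = (u₁ : ZMod q) + 1 := by push_cast; ring
  have c4 : ((1 * (u₁ - 1) : ℤ) : ZMod q) = (u₁ : ZMod q) - 1 := by push_cast; ring
  have c5 : ((1 * (p₂ + 1) : ℤ) : ZMod q) = (p₂ : ZMod q) + 1 := by push_cast; ring
  have c6 : ((1 * (p₂ - 1) : ℤ) : ZMod q) = (p₂ : ZMod q) - 1 := by push_cast; ring
  have c7 : ((1 * (u₂ + 1) : ℤ) : ZMod q) = (u₂ : ZMod q) + 1 := by push_cast; ring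
  have c8 : ((1 * (u₂ - 1) : ℤ) : ZMod q) = (u₂ : ZMod q) - 1 := by push_cast; ring
  rw [c1, c2, c3, c4, c5, c6, c7, c8] at hrel
  -- the hypotheses of the combinatorial core, in the field `ℤ/q`
  have hUP := cast_mul_cast_eq_one' hu₁
  have hVQ := cast_mul_cast_eq_one' hu₂
  have hP1 : (p₁ : ZMod q) + 1 ≠ 0 := by have := cast_ne_zero_of_not_dvd hhom₁.2; push_cast at this; exact this
  have hP2 : (p₁ : ZMod q) - 1 ≠ 0 := by have := cast_ne_zero_of_not_dvd hhom₁.1; push_cast at this; exact this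
  have hQ1 : (p₂ : ZMod q) + 1 ≠ 0 := by have := cast_ne_zero_of_not_dvd hhom₂.2; push_cast at this; exact this
  have hQ2 : (p₂ : ZMod q) - 1 ≠ 0 := by have := cast_ne_zero_of_not_dvd hhom₂.1; push_cast at this; exact this
  have hU1 : (u₁ : ZMod q) + 1 ≠ 0 := fun h0 ↦ hP1 (by
    have hU : (u₁ : ZMod q) = -1 := by linear_combination h0
    rw [hU] at hUP; linear_combination -hUP)
  have hU2 : (u₁ : ZMod q) - 1 ≠ 0 := fun h0 ↦ hP2 (by
    have hU : (u₁ : ZMod q) = 1 := by linear_combination h0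
    rw [hU] at hUP; linear_combination hUP)
  have hV1 : (u₂ : ZMod q) + 1 ≠ 0 := fun h0 ↦ hQ1 (by
    have hV : (u₂ : ZMod q) = -1 := by linear_combination h0
    rw [hV] at hVQ; linear_combination -hVQ)
  have hV2 : (u₂ : ZMod q) - 1 ≠ 0 := fun h0 ↦ hQ2 (by
    have hV : (u₂ : ZMod q) = 1 := by linear_combination h0
    rw [hV] at hVQ; linear_combination hVQ)
  have hP0 : (p₁ : ZMod q) ≠ 0 := fun h0 ↦ by rw [h0, mul_zero] at hUP; exact zero_ne_one hUP
  have hU0 : (u₁ : ZMod q) ≠ 0 := fun h0 ↦ by rw [h0, zero_mul] at hUP; exact zero_ne_one hUP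
  have hQ0 : (p₂ : ZMod q) ≠ 0 := fun h0 ↦ by rw [h0, mul_zero] at hVQ; exact zero_ne_one hVQ
  have hV0 : (u₂ : ZMod q) ≠ 0 := fun h0 ↦ by rw [h0, zero_mul] at hVQ; exact zero_ne_one hVQ
  have h2u : IsUnit (2 : ZMod q) := by
    rw [isUnit_iff_ne_zero]
    intro h0
    apply h2
    rw [mul_one]
    exact (ZMod.intCast_zmod_eq_zero_iff_dvd 2 q).mp (by exact_mod_cast h0)
  have key := eq_or_eq_neg_of_cot_relation hq3 h2u hP0 hU0 hQ0 hV0 (isUnit_iff_ne_zero.mpr hP1)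
    (isUnit_iff_ne_zero.mpr hP2) (isUnit_iff_ne_zero.mpr hU1) (isUnit_iff_ne_zero.mpr hU2) (isUnit_iff_ne_zero.mpr hQ1)
    (isUnit_iff_ne_zero.mpr hQ2) (isUnit_iff_ne_zero.mpr hV1) (isUnit_iff_ne_zero.mpr hV2) hrel
  -- back to congruences
  rcases key with e | e | e | e
  · refine Or.inl ((ZMod.intCast_zmod_eq_zero_iff_dvd _ _).mp ?_)
    push_cast; rw [e]; ring
  · refine Or.inr (Or.inl ((ZMod.intCast_zmod_eq_zero_iff_dvd _ _).mp ?_))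
    push_cast; rw [e]; ring
  · refine Or.inr (Or.inr (Or.inl ((ZMod.intCast_zmod_eq_zero_iff_dvd _ _).mp ?_)))
    push_cast; rw [e]; linear_combination hUP
  · refine Or.inr (Or.inr (Or.inr ((ZMod.intCast_zmod_eq_zero_iff_dvd _ _).mp ?_)))
    push_cast; rw [e]; linear_combination -hUP

/-- **MAIN THEOREM (Ikeda–Yamamoto 1979) for an odd prime `q`, general weights.** Let `q` be an odd prime and `p₁, p₂, p₁',
p₂'` prime to `q`. If `L(q; p₁, p₂)` and `L(q; p₁', p₂')` are isospectral (`dim E_{n(n+2)}` agree for all `n`), then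
`p₁p₂' ≡ ±p₁'p₂` or `p₁p₁' ≡ ±p₂p₂' (mod q)` — equivalently (Proposition 1.1 / Ikeda's Theorem 2.1 (4),
`lensWeightsEquivalent_two_iff` below) `(p₁', p₂')` is a permutation of `(ε₁lp₁, ε₂lp₂) mod q` for some `l` and signs `εᵢ`:
the two lens spaces are isometric. (Reduction to the normalized form via `L(q; p₁, p₂) ≅ L(q; 1, p₁*p₂)`, the tree's
`lensMultiplicity_eq_one_left`.) [cite: IkedaYamamoto1979, Main Theorem (`q` an odd prime), §4 ("we may assume `p₀ = 1`"),
Proposition 1.1] -/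
theorem dvd_of_lensMultiplicity_eq_of_prime {q : ℕ} [hq : Fact q.Prime] (hq2 : q ≠ 2) {p₁ p₂ p₁' p₂' : ℤ}
    (hp₁ : IsCoprime p₁ q) (hp₂ : IsCoprime p₂ q) (hp₁' : IsCoprime p₁' q) (hp₂' : IsCoprime p₂' q)
    (h : ∀ n : ℕ, lensMultiplicity q p₁ p₂ n = lensMultiplicity q p₁' p₂' n) :
    (q : ℤ) ∣ p₁ * p₂' - p₁' * p₂ ∨ (q : ℤ) ∣ p₁ * p₂' + p₁' * p₂ ∨
      (q : ℤ) ∣ p₁ * p₁' - p₂ * p₂' ∨ (q : ℤ) ∣ p₁ * p₁' + p₂ * p₂' := by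
  obtain ⟨u₁, b₁, hub₁⟩ := hp₁
  obtain ⟨u₁', b₁', hub₁'⟩ := hp₁'
  have hu₁ : (q : ℤ) ∣ u₁ * p₁ - 1 := ⟨-b₁, by linear_combination hub₁⟩
  have hu₁' : (q : ℤ) ∣ u₁' * p₁' - 1 := ⟨-b₁', by linear_combination hub₁'⟩
  have hcu₁ : IsCoprime u₁ q := ⟨p₁, b₁, by linear_combination hub₁⟩
  have hcu₁' : IsCoprime u₁' q := ⟨p₁', b₁', by linear_combination hub₁'⟩
  have hred : ∀ n : ℕ, lensMultiplicity q 1 (u₁ * p₂) n = lensMultiplicity q 1 (u₁' * p₂') n := fun n ↦ by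
    rw [← lensMultiplicity_eq_one_left q hu₁ p₂ n, h n, lensMultiplicity_eq_one_left q hu₁' p₂' n]
  have key := dvd_of_lensMultiplicity_one_eq_of_prime hq2 (hcu₁.mul_left hp₂) (hcu₁'.mul_left hp₂') hred
  have eU := cast_mul_cast_eq_one' hu₁
  have eU' := cast_mul_cast_eq_one' hu₁'
  have cast0 : ∀ {t : ℤ}, (q : ℤ) ∣ t → (t : ZMod q) = 0 := fun ht ↦ (ZMod.intCast_zmod_eq_zero_iff_dvd _ _).mpr ht
  rcases key with e | e | e | e
  · have e' := cast0 e
    push_cast at e'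
    refine Or.inl ((ZMod.intCast_zmod_eq_zero_iff_dvd _ _).mp ?_)
    push_cast
    linear_combination (-((p₁ : ZMod q) * (p₁' : ZMod q))) * e' + ((p₁' : ZMod q) * (p₂ : ZMod q)) * eU -
      ((p₁ : ZMod q) * (p₂' : ZMod q)) * eU'
  · have e' := cast0 e
    push_cast at e'
    refine Or.inr (Or.inl ((ZMod.intCast_zmod_eq_zero_iff_dvd _ _).mp ?_))
    push_cast
    linear_combination ((p₁ : ZMod q) * (p₁' : ZMod q)) * e' - ((p₁' : ZMod q) * (p₂ : ZMod q)) * eU -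
      ((p₁ : ZMod q) * (p₂' : ZMod q)) * eU'
  · have e' := cast0 e
    push_cast at e'
    refine Or.inr (Or.inr (Or.inl ((ZMod.intCast_zmod_eq_zero_iff_dvd _ _).mp ?_)))
    push_cast
    linear_combination (-((p₁ : ZMod q) * (p₁' : ZMod q))) * e' +
      ((p₂ : ZMod q) * (p₂' : ZMod q) * (u₁' : ZMod q) * (p₁' : ZMod q)) * eU + ((p₂ : ZMod q) * (p₂' : ZMod q)) * eU'
  · have e' := cast0 e
    push_cast at e'
    refine Or.inr (Or.inr (Or.inr ((ZMod.intCast_zmod_eq_zero_iff_dvd _ _).mp ?_)))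
    push_cast
    linear_combination ((p₁ : ZMod q) * (p₁' : ZMod q)) * e' -
      ((p₂ : ZMod q) * (p₂' : ZMod q) * (u₁' : ZMod q) * (p₁' : ZMod q)) * eU - ((p₂ : ZMod q) * (p₂' : ZMod q)) * eU'

/-- A permutation of `Fin 2` fixes `0` and `1` or swaps them. [folklore] -/
private theorem perm_fin_two (σ : Equiv.Perm (Fin 2)) : (σ 0 = 0 ∧ σ 1 = 1) ∨ (σ 0 = 1 ∧ σ 1 = 0) := by
  have h0 : σ 0 = 0 ∨ σ 0 = 1 := by
    rcases Fin.exists_fin_two.mp ⟨σ 0, rfl⟩ with h | h <;> [exact Or.inl h; exact Or.inr h]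
  have h1 : σ 1 = 0 ∨ σ 1 = 1 := by
    rcases Fin.exists_fin_two.mp ⟨σ 1, rfl⟩ with h | h <;> [exact Or.inl h; exact Or.inr h]
  have hne : σ 0 ≠ σ 1 := fun h ↦ absurd (σ.injective h) (by decide)
  rcases h0 with h0 | h0 <;> rcases h1 with h1 | h1
  · exact absurd (h0.trans h1.symm) hne
  · exact Or.inl ⟨h0, h1⟩
  · exact Or.inr ⟨h0, h1⟩
  · exact absurd (h0.trans h1.symm) hne

/-- **PROPOSITION 4.1 (Ikeda–Yamamoto 1979) / PROPOSITION 1.1 for `n + 1 = 2`, as an equivalence of arithmetic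
conditions.** For weights `p₁'` prime to `q`: Ikeda's isometry criterion `LensWeightsEquivalent q (p₁, p₂) (p₁', p₂')`
("`(p₁, p₂)` is a permutation of `(ε₁lp₁', ε₂lp₂') mod q`", [Ikeda1980] Theorem 2.1 (4) = Proposition 1.1 of the source and its
converse) holds iff `p₁p₂' ≡ ±p₁'p₂` or `p₁p₁' ≡ ±p₂p₂' (mod q)`; for `(p₁, p₂) = (1, p)`, `(p₁', p₂') = (1, p')` these are
(4.1) `p ≡ ±p'` and (4.2) `pp' ≡ ±1`. [cite: IkedaYamamoto1979, Proposition 4.1, Proposition 1.1]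
[cite: Ikeda1980, Theorem 2.1 (4)] -/
theorem lensWeightsEquivalent_two_iff {q : ℕ} {p₁ p₂ p₁' p₂' : ℤ} (hp₁' : IsCoprime p₁' q) :
    LensWeightsEquivalent q ![p₁, p₂] ![p₁', p₂'] ↔
      ((q : ℤ) ∣ p₁ * p₂' - p₁' * p₂ ∨ (q : ℤ) ∣ p₁ * p₂' + p₁' * p₂ ∨
        (q : ℤ) ∣ p₁ * p₁' - p₂ * p₂' ∨ (q : ℤ) ∣ p₁ * p₁' + p₂ * p₂') := by
  have toZ : ∀ {a b : ℤ}, a ≡ b [ZMOD q] → (a : ZMod q) = (b : ZMod q) := fun h ↦ (ZMod.intCast_eq_intCast_iff _ _ _).mpr h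
  have ofZ : ∀ {a b : ℤ}, (a : ZMod q) = (b : ZMod q) → a ≡ b [ZMOD q] := fun h ↦ (ZMod.intCast_eq_intCast_iff _ _ _).mp h
  have dvdZ : ∀ {t : ℤ}, (t : ZMod q) = 0 → (q : ℤ) ∣ t := fun h ↦ (ZMod.intCast_zmod_eq_zero_iff_dvd _ _).mp h
  constructor
  · rintro ⟨l, e, he, σ, hσ⟩
    have hsign : ∀ i, (e i : ZMod q) = 1 ∨ (e i : ZMod q) = -1 := fun i ↦ by
      rcases he i with h | h <;> simp [h]
    rcases perm_fin_two σ with ⟨h0, h1⟩ | ⟨h0, h1⟩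
    · have e0 := toZ (hσ 0)
      have e1 := toZ (hσ 1)
      rw [h0] at e0
      rw [h1] at e1
      simp only [Matrix.cons_val_zero, Matrix.cons_val_one] at e0 e1
      push_cast at e0 e1
      rcases hsign 0 with s0 | s0 <;> rw [s0] at e0
      · rcases hsign 1 with s1 | s1 <;> rw [s1] at e1
        · exact Or.inl (dvdZ (by push_cast; linear_combination (p₂' : ZMod q) * e0 - (p₁' : ZMod q) * e1))
        · exact Or.inr (Or.inl (dvdZ (by push_cast; linear_combination (p₂' : ZMod q) * e0 + (p₁' : ZMod q) * e1)))
      · rcases hsign 1 with s1 | s1 <;> rw [s1] at e1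
        · exact Or.inr (Or.inl (dvdZ (by push_cast; linear_combination (p₂' : ZMod q) * e0 + (p₁' : ZMod q) * e1)))
        · exact Or.inl (dvdZ (by push_cast; linear_combination (p₂' : ZMod q) * e0 - (p₁' : ZMod q) * e1))
    · have e0 := toZ (hσ 0)
      have e1 := toZ (hσ 1)
      rw [h0] at e0
      rw [h1] at e1
      simp only [Matrix.cons_val_zero, Matrix.cons_val_one] at e0 e1
      push_cast at e0 e1
      rcases hsign 0 with s0 | s0 <;> rw [s0] at e0
      · rcases hsign 1 with s1 | s1 <;> rw [s1] at e1
        · exact Or.inr (Or.inr (Or.inl (dvdZ (by push_cast; linear_combination -(p₂' : ZMod q) * e0 + (p₁' : ZMod q) * e1))))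
        · exact Or.inr (Or.inr (Or.inr (dvdZ (by push_cast; linear_combination (p₂' : ZMod q) * e0 + (p₁' : ZMod q) * e1))))
      · rcases hsign 1 with s1 | s1 <;> rw [s1] at e1
        · exact Or.inr (Or.inr (Or.inr (dvdZ (by push_cast; linear_combination (p₂' : ZMod q) * e0 + (p₁' : ZMod q) * e1))))
        · exact Or.inr (Or.inr (Or.inl (dvdZ (by push_cast; linear_combination -(p₂' : ZMod q) * e0 + (p₁' : ZMod q) * e1))))
  · intro hd
    obtain ⟨u, b, hub⟩ := hp₁'
    have eU : (u : ZMod q) * (p₁' : ZMod q) = 1 := cast_mul_cast_eq_one' ⟨-b, by linear_combination hub⟩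
    have cast0 : ∀ {t : ℤ}, (q : ℤ) ∣ t → (t : ZMod q) = 0 := fun ht ↦ (ZMod.intCast_zmod_eq_zero_iff_dvd _ _).mpr ht
    rcases hd with e | e | e | e <;> have e' := cast0 e <;> push_cast at e'
    · refine ⟨u * p₁, ![1, 1], fun i ↦ by fin_cases i <;> simp, Equiv.refl _, fun i ↦ ofZ ?_⟩
      fin_cases i
      · simp only [Equiv.refl_apply, Fin.zero_eta, Matrix.cons_val_zero]; push_cast
        linear_combination -(p₁ : ZMod q) * eU
      · simp only [Equiv.refl_apply, Fin.mk_one, Matrix.cons_val_one]; push_cast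
        linear_combination -(p₂ : ZMod q) * eU - (u : ZMod q) * e'
    · refine ⟨u * p₁, ![1, -1], fun i ↦ by fin_cases i <;> simp, Equiv.refl _, fun i ↦ ofZ ?_⟩
      fin_cases i
      · simp only [Equiv.refl_apply, Fin.zero_eta, Matrix.cons_val_zero]; push_cast
        linear_combination -(p₁ : ZMod q) * eU
      · simp only [Equiv.refl_apply, Fin.mk_one, Matrix.cons_val_one]; push_cast
        linear_combination -(p₂ : ZMod q) * eU + (u : ZMod q) * e'
    · refine ⟨u * p₂, ![1, 1], fun i ↦ by fin_cases i <;> simp, Equiv.swap 0 1, fun i ↦ ofZ ?_⟩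
      fin_cases i
      · simp only [Fin.zero_eta, Equiv.swap_apply_left, Matrix.cons_val_one, Matrix.cons_val_zero]
        push_cast
        linear_combination -(p₂ : ZMod q) * eU
      · simp only [Fin.mk_one, Equiv.swap_apply_right, Matrix.cons_val_zero, Matrix.cons_val_one]
        push_cast
        linear_combination -(p₁ : ZMod q) * eU + (u : ZMod q) * e'
    · refine ⟨u * p₂, ![1, -1], fun i ↦ by fin_cases i <;> simp, Equiv.swap 0 1, fun i ↦ ofZ ?_⟩
      fin_cases i
      · simp only [Fin.zero_eta, Equiv.swap_apply_left, Matrix.cons_val_one, Matrix.cons_val_zero]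
        push_cast
        linear_combination -(p₂ : ZMod q) * eU
      · simp only [Fin.mk_one, Equiv.swap_apply_right, Matrix.cons_val_zero, Matrix.cons_val_one]
        push_cast
        linear_combination -(p₁ : ZMod q) * eU + (u : ZMod q) * e'

/-- **ISOSPECTRAL ⟺ ISOMETRIC for three-dimensional lens spaces with fundamental group of odd prime order** (the Main
Theorem of Ikeda–Yamamoto for `q` prime, packaged with its easy converse): for `q` an odd prime and weights prime to `q`, the
lens spaces `L(q; p₁, p₂)` and `L(q; p₁', p₂')` have the same multiplicities `dim E_{n(n+2)}` for all `n` iff they satisfy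
Ikeda's isometry criterion `LensWeightsEquivalent` ((4.1)/(4.2)); the converse direction is the tree's
`LensWeightsEquivalent.lensSpaceMultiplicity_eq` (Proposition 1.1: equivalent weights give isometric, hence isospectral,
spaces). "A 3-dimensional lens space is completely characterized by its spectrum as a riemannian manifold" (for these `q`).
[cite: IkedaYamamoto1979, Main Theorem and the Theorem of the Introduction (`q` an odd prime), Proposition 1.1, Proposition
4.1] [cite: Ikeda1980, Theorem 2.1] -/
theorem lensMultiplicity_eq_iff_lensWeightsEquivalent_of_prime {q : ℕ} [hq : Fact q.Prime] (hq2 : q ≠ 2)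
    {p₁ p₂ p₁' p₂' : ℤ} (hp₁ : IsCoprime p₁ q) (hp₂ : IsCoprime p₂ q) (hp₁' : IsCoprime p₁' q) (hp₂' : IsCoprime p₂' q) :
    (∀ n : ℕ, lensMultiplicity q p₁ p₂ n = lensMultiplicity q p₁' p₂' n) ↔ LensWeightsEquivalent q ![p₁, p₂] ![p₁', p₂'] := by
  constructor
  · intro h
    exact (lensWeightsEquivalent_two_iff hp₁').mpr (dvd_of_lensMultiplicity_eq_of_prime hq2 hp₁ hp₂ hp₁' hp₂' h)
  · intro hE n
    have hc : ∀ i : Fin 2, IsCoprime (![p₁, p₂] i) q := fun i ↦ by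
      fin_cases i
      · simpa using hp₁
      · simpa using hp₂
    have := LensWeightsEquivalent.lensSpaceMultiplicity_eq (q := q) hq.out.ne_zero hE hc n
    rwa [lensSpaceMultiplicity_two, lensSpaceMultiplicity_two] at this

end Literature.Analysis.InnerProduct
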